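import Literature.Probability.Percolation.SiteIfaceWinding
import HarnessLib

/-!
# Winding numbers of a closed lattice polyline around a transit vertex: the two fans of faces

Topic `Literature/Probability/Percolation`; family `crit-perc`. An addition to the
winding-number bookkeeping of `TriLoopWinding.lean` / `SiteIfaceWinding.lean` (the tree's
substitute for the Jordan curve theorem), prepared for the separation-free counting proof of the
five-arm upper bound (W. Werner, *Lectures on two-dimensional critical percolation*, PCMI 2009,
first exercise sheet, "Five-arm exponent", 2) b): "there are at most two points `x` … on their
joint boundary such that `U_{2m}(x)` holds"; `FiveArmSiteCharge.lean`).

A vertex `v` of a closed lattice polyline of `𝕋` is a **transit vertex** with outgoing direction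
`o` and incoming direction `o + d` (`d ≠ 0`) if the only pieces of the polyline at `v` are the
dart `v → v + e_o`, traversed once, and the dart `v + e_{o+d} → v` (`IsTransit`). Around such a
vertex the six faces `f_k = leftFaceDir v k` (the face between the directions `k` and `k + 1`)
split into two fans on which the winding number is constant — the **left fan**
`f_o, …, f_{o+d-1}` and the **right fan** `f_{o+d}, …, f_{o+5}` — and the value on the left fan
exceeds the value on the right fan by one:

* the lattice identities behind it (`faceVertex_leftFaceDir_succ`, `…_one_one`, …,
  `oppFace_leftFaceDir_right`, `oppFace_leftFaceDir_next`, `leftFaceDir_add_triDir`);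
* `IsTransit.latWind_face_succ` (adjacent faces across a non-piece side agree),
  `IsTransit.latWind_left_sub_right` (the signed jump across the outgoing dart),
  `IsTransit.latWind_face_left`, `IsTransit.latWind_face_right` (the two fans are constant);
* `IsTransit.latWind_site_left/right` — a neighbour `v + e_k` which is not a vertex of the
  polyline has the winding number of its fan (`0 < k - o < d`, resp. `d < k - o`);
* `exists_adj_of_pathIn_of_latWind_ne` — a lattice path inside a set of sites all of which,
  except possibly `w`, are off the polyline, and whose endpoints have different winding numbers,
  passes through `w`, arriving from a neighbour with the winding number of its start.

Everything is folklore (argument-principle bookkeeping); no events, no named facts.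

## References

* W. Werner, *Lectures on two-dimensional critical percolation*, IAS/Park City Math. Ser. 16
  (2009), first exercise sheet, "Five-arm exponent", 2) b) [WernerPCMI2009].
* B. Bollobás, O. Riordan, *Percolation*, CUP (2006), Ch. 7 §7.2.3 (winding numbers in place of
  the Jordan curve theorem) [BollobasRiordan2006].

## Mathlib / tree

Tree: `latWind`, `latPieces`, `latWind_hexCenter_eq_of_forall_not_side`,
`latWind_hexCenter_sub_eq_one_of_side`, `latWind_hexCenter_eq_latWind_faceVertex`
(`TriLoopWinding.lean`), `latWind_triEmbed_eq_of_pathIn` (`SiteIfaceWinding.lean`), `triDir`,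
`leftFaceDir`, `leftFaceIdx`, `faceVertex_leftFaceDir`, `faceDartDir_leftFaceDir`, `faceVertex_succ`
(`TriDiscShelling.lean`), `faceVertex`, `oppFace` (`TriDiscreteDomain.lean`), `PathIn.exit_or`
(`SitePaths.lean`).
-/

noncomputable section

open Complex Set Literature.Topology.PlaneTopology Literature.Combinatorics.Enumerative

namespace Literature.Probability.Percolation

open LatticeModels

/-! ### The six faces around a site -/

/-- The second vertex of the face `leftFaceDir v k` (after `v`) is `v + e_k`. [folklore] -/
theorem faceVertex_leftFaceDir_succ (v : Site 2) (k : Fin 6) :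
    faceVertex (leftFaceDir v k) (leftFaceIdx k + 1) = v + triDir k := by
  rw [faceVertex_succ, faceVertex_leftFaceDir, faceDartDir_leftFaceDir]

/-- The third vertex of the face `leftFaceDir v k` is `v + e_{k+1}`. [folklore] -/
theorem faceVertex_leftFaceDir_one_one (v : Site 2) (k : Fin 6) :
    faceVertex (leftFaceDir v k) (leftFaceIdx k + 1 + 1) = v + triDir (k + 1) := by
  fin_cases k <;> (ext i; fin_cases i <;> simp [faceVertex, leftFaceDir, leftFaceIdx, triDir] <;> omega)

/-- Back to the first vertex: `leftFaceIdx k + 1 + 2 = leftFaceIdx k`. [folklore] -/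
theorem faceVertex_leftFaceDir_one_two (v : Site 2) (k : Fin 6) :
    faceVertex (leftFaceDir v k) (leftFaceIdx k + 1 + 2) = v := by
  fin_cases k <;> (ext i; fin_cases i <;> simp [faceVertex, leftFaceDir, leftFaceIdx])

/-- Back to the first vertex: `leftFaceIdx k + 2 + 1 = leftFaceIdx k`. [folklore] -/
theorem faceVertex_leftFaceDir_two_one (v : Site 2) (k : Fin 6) :
    faceVertex (leftFaceDir v k) (leftFaceIdx k + 2 + 1) = v := by
  fin_cases k <;> (ext i; fin_cases i <;> simp [faceVertex, leftFaceDir, leftFaceIdx])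

/-- The second vertex again: `leftFaceIdx k + 2 + 2 = leftFaceIdx k + 1`. [folklore] -/
theorem faceVertex_leftFaceDir_two_two (v : Site 2) (k : Fin 6) :
    faceVertex (leftFaceDir v k) (leftFaceIdx k + 2 + 2) = v + triDir k := by
  fin_cases k <;> (ext i; fin_cases i <;> simp [faceVertex, leftFaceDir, leftFaceIdx, triDir] <;> omega)

/-- **The face to the right of the dart `v → v + e_k`** (across it from `leftFaceDir v k`) is the
previous face `leftFaceDir v (k + 5)` around `v`. [folklore] -/
theorem oppFace_leftFaceDir_right (v : Site 2) (k : Fin 6) :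
    oppFace (leftFaceDir v k) (leftFaceIdx k + 2) = leftFaceDir v (k + 5) := by
  fin_cases k <;> (simp [leftFaceDir, leftFaceIdx, oppFace]; try (ext i; fin_cases i <;> simp))

/-- **The next face around `v`**: across the side `{v + e_{k+1}, v}` of `leftFaceDir v k` lies
`leftFaceDir v (k + 1)`. [folklore] -/
theorem oppFace_leftFaceDir_next (v : Site 2) (k : Fin 6) :
    oppFace (leftFaceDir v k) (leftFaceIdx k + 1) = leftFaceDir v (k + 1) := by
  fin_cases k <;> (simp [leftFaceDir, leftFaceIdx, oppFace]; try (ext i; fin_cases i <;> simp))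

/-- **The face to the left of `v → v + e_k`, seen from the other endpoint**: it is the face
`leftFaceDir (v + e_k) (k + 2)` around `v + e_k`. [folklore] -/
theorem leftFaceDir_add_triDir (v : Site 2) (k : Fin 6) :
    leftFaceDir (v + triDir k) (k + 2) = leftFaceDir v k := by
  fin_cases k <;> simp [leftFaceDir, triDir] <;> (ext i; fin_cases i <;> simp <;> omega)

/-! ### Small facts about `Fin 6` -/

/-- `(a - 1 : Fin 6) = a - 1` on values, away from `0`. [folklore] -/
theorem fin6_val_sub_one {a : Fin 6} (h : a ≠ 0) : ((a - 1 : Fin 6) : ℕ) = (a : ℕ) - 1 := by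
  rw [Fin.coe_sub_one, if_neg h]

/-- `(a + 1 : Fin 6) = a + 1` on values, away from `5`. [folklore] -/
theorem fin6_val_add_one {a : Fin 6} (h : (a : ℕ) < 5) : ((a + 1 : Fin 6) : ℕ) = (a : ℕ) + 1 := by
  rw [Fin.val_add_one, if_neg]
  intro he; rw [he] at h; simp at h

/-! ### Transit vertices -/

/-- **A transit vertex** `v` of the closed lattice polyline through `v₀ :: l`, with outgoing
direction `o` and incoming direction `o + d`: all pieces are points or unit edges, every piece
starting at `v` is the dart `v → v + e_o`, every piece ending at `v` is the dart
`v + e_{o+d} → v`, exactly one piece starts at `v`, and `d ≠ 0`. [folklore] -/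
structure IsTransit (v₀ : Site 2) (l : List (Site 2)) (v : Site 2) (o d : Fin 6) : Prop where
  adj : ∀ p ∈ latPieces v₀ l, p.1 = p.2 ∨ triGraph.Adj p.1 p.2
  fst_eq : ∀ p ∈ latPieces v₀ l, p.1 = v → p.2 = v + triDir o
  snd_eq : ∀ p ∈ latPieces v₀ l, p.2 = v → p.1 = v + triDir (o + d)
  count_eq : (latPieces v₀ l).countP (fun p => p.1 = v) = 1
  ne : d ≠ 0

namespace IsTransit

variable {v₀ : Site 2} {l : List (Site 2)} {v : Site 2} {o d : Fin 6}

/-- The outgoing dart occurs in the list of pieces, the remaining pieces neither start at `v`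
nor are the reversed dart. [folklore] -/
theorem exists_split (h : IsTransit v₀ l v o d) :
    ∃ L₁ L₂, latPieces v₀ l = L₁ ++ (v, v + triDir o) :: L₂ ∧
      ∀ p ∈ L₁ ++ L₂, ¬ ((p.1 = v ∧ p.2 = v + triDir o) ∨ (p.1 = v + triDir o ∧ p.2 = v)) := by
  -- some piece starts at `v`
  have hpos : 0 < (latPieces v₀ l).countP (fun p => p.1 = v) := by rw [h.count_eq]; exact Nat.one_pos
  obtain ⟨q, hq, hq1⟩ := List.countP_pos_iff.1 hpos
  have hq1 : q.1 = v := by simpa using hq1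
  have hq2 : q.2 = v + triDir o := h.fst_eq q hq hq1
  obtain ⟨L₁, L₂, hL⟩ := List.append_of_mem hq
  have hqe : q = (v, v + triDir o) := Prod.ext hq1 hq2
  rw [hqe] at hL
  refine ⟨L₁, L₂, hL, fun p hp => ?_⟩
  -- no other piece starts at `v`
  have hcount : (L₁ ++ L₂).countP (fun p => p.1 = v) = 0 := by
    have := h.count_eq
    rw [hL, List.countP_append, List.countP_cons] at this
    simp only [decide_true, ite_true] at this
    rw [List.countP_append]
    omega
  have hp1 : p.1 ≠ v := by
    intro hpv
    have : 0 < (L₁ ++ L₂).countP (fun p => p.1 = v) := List.countP_pos_iff.2 ⟨p, hp, by simpa using hpv⟩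
    omega
  rintro (⟨h1, -⟩ | ⟨h1, h2⟩)
  · exact hp1 h1
  · -- the reversed dart would end at `v`, hence start at `v + e_{o+d} ≠ v + e_o`
    have hp' : p ∈ latPieces v₀ l := by
      rw [hL]; simp only [List.mem_append, List.mem_cons] at hp ⊢; tauto
    have := h.snd_eq p hp' h2
    rw [h1] at this
    have hod : o = o + d := triDir_injective (add_left_cancel this)
    exact h.ne (left_eq_add.1 hod)

/-- **Adjacent faces around a transit vertex agree across a side which is not a piece**: if the
direction `k + 1` is neither the outgoing nor the incoming one, the faces `leftFaceDir v k` and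
`leftFaceDir v (k + 1)` (sharing the side `{v, v + e_{k+1}}`) have the same winding number. [folklore] -/
theorem latWind_face_succ (h : IsTransit v₀ l v o d) {k : Fin 6} (hk₁ : k + 1 ≠ o) (hk₂ : k + 1 ≠ o + d) :
    latWind v₀ l (hexCenter (leftFaceDir v k)) = latWind v₀ l (hexCenter (leftFaceDir v (k + 1))) := by
  rw [← oppFace_leftFaceDir_next v k]
  refine latWind_hexCenter_eq_of_forall_not_side h.adj fun p hp => ?_
  rw [faceVertex_leftFaceDir_one_one, faceVertex_leftFaceDir_one_two]
  rintro (⟨h1, h2⟩ | ⟨h1, h2⟩)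
  · -- a piece `v + e_{k+1} → v` ends at `v`
    have := h.snd_eq p hp h2
    rw [h1] at this
    exact hk₂ (triDir_injective (add_left_cancel this))
  · -- a piece `v → v + e_{k+1}` starts at `v`
    have := h.fst_eq p hp h1
    rw [h2] at this
    exact hk₁ (triDir_injective (add_left_cancel this))

/-- **The signed jump across the outgoing dart**: the first face of the left fan exceeds the last
face of the right fan by one, `wind (f_o) - wind (f_{o+5}) = 1`. [folklore] -/
theorem latWind_left_sub_right (h : IsTransit v₀ l v o d) :
    latWind v₀ l (hexCenter (leftFaceDir v o)) - latWind v₀ l (hexCenter (leftFaceDir v (o + 5))) = 1 := by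
  obtain ⟨L₁, L₂, hL, hne⟩ := h.exists_split
  rw [← oppFace_leftFaceDir_right v o]
  refine latWind_hexCenter_sub_eq_one_of_side h.adj (j := leftFaceIdx o + 2) (L₁ := L₁) (L₂ := L₂) ?_ ?_
  · rw [faceVertex_leftFaceDir_two_one, faceVertex_leftFaceDir_two_two]; exact hL
  · intro p hp; rw [faceVertex_leftFaceDir_two_one, faceVertex_leftFaceDir_two_two]; exact hne p hp

/-- **The left fan is constant**: `wind (f_k) = wind (f_o)` whenever `k - o < d` (on values). [folklore] -/
theorem latWind_face_left (h : IsTransit v₀ l v o d) {k : Fin 6} (hk : ((k - o : Fin 6) : ℕ) < (d : ℕ)) :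
    latWind v₀ l (hexCenter (leftFaceDir v k)) = latWind v₀ l (hexCenter (leftFaceDir v o)) := by
  -- induction on the offset `k - o`
  obtain ⟨m, hm⟩ : ∃ m : ℕ, ((k - o : Fin 6) : ℕ) = m := ⟨_, rfl⟩
  induction m generalizing k with
  | zero =>
    have : k - o = 0 := Fin.ext hm
    rw [sub_eq_zero.1 this]
  | succ m ih =>
    have hko : k - o ≠ 0 := fun h0 => by rw [h0] at hm; simp at hm
    -- the previous face `k - 1`
    have hprev : (((k - 1 : Fin 6) - o : Fin 6) : ℕ) = m := by
      have e : (k - 1 : Fin 6) - o = (k - o) - 1 := by abel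
      rw [e, fin6_val_sub_one hko, hm]; rfl
    rw [← ih (by omega) hprev]
    have e1 : (k - 1 : Fin 6) + 1 = k := sub_add_cancel k 1
    conv_lhs => rw [← e1]
    refine (h.latWind_face_succ ?_ ?_).symm
    · rw [e1]; intro he; rw [he, sub_self] at hko; exact hko rfl
    · rw [e1]; intro he
      rw [he, add_sub_cancel_left] at hm
      omega

/-- **The right fan is constant**: `wind (f_k) = wind (f_{o+5})` whenever `d ≤ k - o`. [folklore] -/
theorem latWind_face_right (h : IsTransit v₀ l v o d) {k : Fin 6} (hk : (d : ℕ) ≤ ((k - o : Fin 6) : ℕ)) :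
    latWind v₀ l (hexCenter (leftFaceDir v k)) = latWind v₀ l (hexCenter (leftFaceDir v (o + 5))) := by
  -- descending induction on the offset `k - o`, from `5`
  obtain ⟨m, hm⟩ : ∃ m : ℕ, 5 - ((k - o : Fin 6) : ℕ) = m := ⟨_, rfl⟩
  induction m generalizing k with
  | zero =>
    have h5 : ((k - o : Fin 6) : ℕ) = 5 := by have := (k - o).isLt; omega
    have : k - o = 5 := Fin.ext h5
    have hk5 : k = o + 5 := by rw [← this]; abel
    rw [hk5]
  | succ m ih =>
    have hlt : ((k - o : Fin 6) : ℕ) < 5 := by omega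
    -- the next face `k + 1`
    have hnext : (((k + 1 : Fin 6) - o : Fin 6) : ℕ) = ((k - o : Fin 6) : ℕ) + 1 := by
      have e : (k + 1 : Fin 6) - o = (k - o) + 1 := by abel
      rw [e, fin6_val_add_one hlt]
    rw [← ih (k := k + 1) (by rw [hnext]; omega) (by rw [hnext]; omega)]
    refine h.latWind_face_succ ?_ ?_
    · intro he
      have : (k + 1 : Fin 6) - o = 0 := by rw [he, sub_self]
      rw [this] at hnext; simp at hnext
    · intro he
      have : (k + 1 : Fin 6) - o = d := by rw [he, add_sub_cancel_left]
      rw [this] at hnext; omega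

/-- **A neighbour of a transit vertex which is on no piece has the winding number of its fan —
left fan**: for `v + e_k` with `k - o < d` (for `k = o` the hypothesis fails, `v + e_o` being a
vertex). [folklore] -/
theorem latWind_site_left (h : IsTransit v₀ l v o d) {k : Fin 6} (hk : ((k - o : Fin 6) : ℕ) < (d : ℕ))
    (hv : ∀ p ∈ latPieces v₀ l, v + triDir k ≠ p.1 ∧ v + triDir k ≠ p.2) :
    latWind v₀ l (triEmbed (v + triDir k)) = latWind v₀ l (hexCenter (leftFaceDir v o)) := by
  rw [← h.latWind_face_left hk, ← faceVertex_leftFaceDir_succ v k]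
  refine (latWind_hexCenter_eq_latWind_faceVertex h.adj fun p hp => ?_).symm
  rw [faceVertex_leftFaceDir_succ]
  exact hv p hp

/-- **… right fan**: for `v + e_k` with `d < k - o`. [folklore] -/
theorem latWind_site_right (h : IsTransit v₀ l v o d) {k : Fin 6} (hk : (d : ℕ) < ((k - o : Fin 6) : ℕ))
    (hv : ∀ p ∈ latPieces v₀ l, v + triDir k ≠ p.1 ∧ v + triDir k ≠ p.2) :
    latWind v₀ l (triEmbed (v + triDir k)) = latWind v₀ l (hexCenter (leftFaceDir v (o + 5))) := by
  rw [← h.latWind_face_right hk.le, ← faceVertex_leftFaceDir_succ v k]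
  refine (latWind_hexCenter_eq_latWind_faceVertex h.adj fun p hp => ?_).symm
  rw [faceVertex_leftFaceDir_succ]
  exact hv p hp

end IsTransit

/-! ### A path whose endpoints have different winding numbers passes through the exceptional site -/

/-- **Exit through the only possible vertex.** Let `S` be a set of sites all of which, except
possibly `w`, lie on no piece of the closed polyline, and let a `𝕋`-path inside `S` join `k ≠ w`
to `z` with `wind k ≠ wind z`. Then the path passes through `w`: `w ∈ S`, and some site `k' ∈ S`,
`k' ≠ w`, adjacent to `w`, has `wind k' = wind k` (the last site before the first visit to `w`).
[folklore] -/
theorem exists_adj_of_pathIn_of_latWind_ne {v₀ : Site 2} {l : List (Site 2)}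
    (hadj : ∀ p ∈ latPieces v₀ l, p.1 = p.2 ∨ triGraph.Adj p.1 p.2) {S : Set (Site 2)} {w : Site 2}
    (hS : ∀ z ∈ S, z ≠ w → ∀ p ∈ latPieces v₀ l, z ≠ p.1 ∧ z ≠ p.2) {k z : Site 2}
    (hp : PathIn triGraph S k z) (hkw : k ≠ w)
    (hne : latWind v₀ l (triEmbed k) ≠ latWind v₀ l (triEmbed z)) :
    w ∈ S ∧ ∃ k' ∈ S, k' ≠ w ∧ triGraph.Adj k' w ∧ latWind v₀ l (triEmbed k') = latWind v₀ l (triEmbed k) := by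
  have hR : ∀ z ∈ ({u | u ≠ w} ∩ S : Set (Site 2)), ∀ p ∈ latPieces v₀ l, z ≠ p.1 ∧ z ≠ p.2 :=
    fun z hz => hS z hz.2 hz.1
  rcases hp.exit_or (R := {u | u ≠ w}) hkw with h' | ⟨a, b, ha, hb, hbS, hab, hpa⟩
  · exact absurd (latWind_triEmbed_eq_of_pathIn hadj hR h') hne
  · have hbw : b = w := by simpa using hb
    subst hbw
    exact ⟨hbS, a, hpa.right_mem.2, ha, hab, (latWind_triEmbed_eq_of_pathIn hadj hR hpa).symm⟩

end Literature.Probability.Percolation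

end
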